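import Summits.CriticalPhenomena.PercolationContinuityZ3.Theorems.Transplant.AutEndStateDefs
import Summits.CriticalPhenomena.PercolationContinuityZ3.Theorems.Transplant.AutEndStateCayley
import Summits.CriticalPhenomena.PercolationContinuityZ3.Theorems.Transplant.CayleyVirtuallyNilpotentDichotomy
import HarnessLib

/-!
# END-STATE CONTINUITY ALONE ⟹ Conjecture 4 for EVERY Cayley graph of EVERY finitely generated VIRTUALLY NILPOTENT group — no Trofimov, no Gromov
# (the Cayley sub-row of class C2 modulo the end-state node and NOTHING else)

builds on p205010 (kernel theorem, internal audit signed; external expert review pending) — nothing in this file uses p205010.  CONDITIONAL on the OPEN statement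
END-STATE CONTINUITY (`BenjaminiSchramm1996_conj4_endState`, hypothesis `hE`, never asserted); nothing else is assumed and nothing is claimed about any node.
Lane `prim-bschramm`, seat `prim-bschramm-p4` gen 28 (PART C3 of `P4-GENERAL.md` §50.7).  Helper file (`--supports stmt-CriticalPhenomena-4575 --as helper`); def-free.

Gen 27 reached the polynomial-growth class through the typed NAMED FACT Trofimov 1985 Thm 2 (`AutPoly.conj4_polynomialGrowth_of_endState`: end-state continuity +
Trofimov ⟹ Conj. 4 for every quasi-transitive graph of polynomial growth).  For CAYLEY graphs the structure theorem is not needed: a finitely generated group `Γ`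
with a NILPOTENT subgroup `N` of finite index (by Gromov's theorem exactly the groups of polynomial growth — R-level, not used) either is virtually cyclic — then
`p_c = 1` on every Cayley graph (gen 22) — or `N` (finitely generated by Schreier, not virtually cyclic) has two INDEPENDENT characters (gen 22's Milnor–Wolf lemma
`Nilpotent.virtuallyCyclic_iff_dependent`), i.e. `vb₁(Γ) ≥ 2`, and gen 27's `EndStateCayley.exists_input_of_vb1` supplies the end-state datum on `Cay(Γ; S)` for
EVERY finite generating `S`.  Hence:
* `EndStateVirtNil.exists_indep_of_not_virtuallyCyclic` — the two independent characters on `N`;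
* **`EndStateVirtNil.criticalContinuity_of_endState`**: END-STATE CONTINUITY ⟹ `θ_g(p_c) = 0` at every vertex of every Cayley graph of every finitely generated
  virtually nilpotent group that is not virtually cyclic;
* **`EndStateVirtNil.conj4_cayley_of_endState`**: END-STATE CONTINUITY ⟹ Conjecture 4 (`p_c < 1 ⟹ θ(p_c) = 0`) for EVERY Cayley graph of EVERY finitely generated
  virtually nilpotent group — the wall groups `vb₁ ≥ 2 > b₁` (`ℤ² ⋊ C₄`-type, `ℤ^p ⋊ C_p` of `AutEndStateTypes`, Hantzsche–Wendt w.r.t. any alphabet) included,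
  with NO named fact; `_of_injective` — the nilpotent subgroup given as an injective homomorphism.
[cite: BenjaminiSchramm1996, Conj. 4; §2 (Cayley graphs); Thm. 1] [cite: MilnorSolvableGrowth1968, Lemma 1] [cite: GrimmettLi2017Amenability, Prop. 18]
[cite: LyonsPeres2016, §7.4 Cor. 7.19]
-/

noncomputable section

namespace Summit.CriticalPhenomena.PercolationContinuityZ3.Theorems.Transplant

open SimpleGraph Literature.Probability.LatticeModels Literature.Probability.Percolation
open scoped Classical

namespace EndStateVirtNil

variable {Γ : Type} [Group Γ]

/-- **A finite-index NILPOTENT subgroup of a finitely generated group that is not virtually cyclic has two independent characters** (`vb₁(Γ) ≥ 2`):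
Schreier (finite generation of `N`) + gen 22's Milnor–Wolf lemma. [cite: MilnorSolvableGrowth1968, Lemma 1] [cite: LyonsPeres2016, §7.9] -/
theorem exists_indep_of_not_virtuallyCyclic [Group.FG Γ] (N : Subgroup Γ) [N.FiniteIndex] [Group.IsNilpotent N]
    (hnvc : ¬ ∃ c : Γ, (Subgroup.zpowers c).FiniteIndex) :
    ∃ (ψ₀ ψ₁ : N →* Multiplicative ℤ) (a b : N),
      Multiplicative.toAdd (ψ₀ a) * Multiplicative.toAdd (ψ₁ b) ≠ Multiplicative.toAdd (ψ₁ a) * Multiplicative.toAdd (ψ₀ b) := by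
  haveI : Group.FG N := Subgroup.fg_of_index_ne_zero N
  obtain ⟨-, A, -, hA⟩ := Group.fg_iff'.1 (inferInstance : Group.FG N)
  have hN : ¬ ∃ c : N, (Subgroup.zpowers c).FiniteIndex :=
    fun ⟨c, hc⟩ => hnvc ⟨(c : Γ), VirtNilpotent.finiteIndex_zpowers_of_subgroup N c hc⟩
  rw [Nilpotent.virtuallyCyclic_iff_dependent A hA] at hN
  push Not at hN
  exact hN

/-- **END-STATE CONTINUITY ⟹ `θ_g(p_c) = 0` on every Cayley graph of every finitely generated VIRTUALLY NILPOTENT group that is not virtually cyclic** —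
no structure theorem (Trofimov / Gromov) is used: the nilpotent finite-index subgroup with its two independent characters IS the end-state input
(gen 27's `EndStateCayley.criticalContinuity_of_endState`).  `hE` is the OPEN end-state statement, never asserted. [cite: BenjaminiSchramm1996, Conj. 4; §2 (Cayley graphs)] -/
theorem criticalContinuity_of_endState (hE : BenjaminiSchramm1996_conj4_endState) (S : Finset Γ) (hS : Subgroup.closure (S : Set Γ) = ⊤)
    (N : Subgroup Γ) [N.FiniteIndex] [Group.IsNilpotent N] (hnvc : ¬ ∃ c : Γ, (Subgroup.zpowers c).FiniteIndex) (g : Γ) :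
    theta (mulCayley (↑S : Set Γ)) g (criticalProbIOf (mulCayley (↑S : Set Γ)) g) = 0 := by
  haveI : Group.FG Γ := ⟨⟨S, hS⟩⟩
  obtain ⟨ψ₀, ψ₁, a, b, hind⟩ := exists_indep_of_not_virtuallyCyclic N hnvc
  exact EndStateCayley.criticalContinuity_of_endState (fun G' _ hc A₀ reps c h1 h2 h3 x => hE G' hc A₀ reps c h1 h2 h3 x) S hS N ψ₀ ψ₁ a b hind g

/-- **END-STATE CONTINUITY ⟹ CONJECTURE 4 FOR EVERY CAYLEY GRAPH OF EVERY FINITELY GENERATED VIRTUALLY NILPOTENT GROUP** (`p_c < 1 ⟹ θ_g(p_c) = 0`, every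
finite generating set, every vertex): `p_c < 1` rules out the virtually cyclic groups (gen 22's `VirtCyc.not_virtuallyCyclic_of_criticalProb_lt_one`), and the
previous theorem applies.  The wall groups (`vb₁ ≥ 2 > b₁`) are included; NO named fact is used. [cite: BenjaminiSchramm1996, Conj. 4; §2 (Cayley graphs)]
[cite: LyonsPeres2016, §7.4 Cor. 7.19] -/
theorem conj4_cayley_of_endState (hE : BenjaminiSchramm1996_conj4_endState) (S : Finset Γ) (hS : Subgroup.closure (S : Set Γ) = ⊤)
    (N : Subgroup Γ) [N.FiniteIndex] [Group.IsNilpotent N] (g : Γ) (hpc : criticalProb (mulCayley (↑S : Set Γ)) g < 1) :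
    theta (mulCayley (↑S : Set Γ)) g (criticalProbIOf (mulCayley (↑S : Set Γ)) g) = 0 :=
  criticalContinuity_of_endState hE S hS N (VirtCyc.not_virtuallyCyclic_of_criticalProb_lt_one S hS g hpc) g

/-- **Injective-homomorphism form**: the nilpotent subgroup given as an injective `φ : N → Γ` from a nilpotent group with image of finite index.
[cite: BenjaminiSchramm1996, Conj. 4; §2 (Cayley graphs)] -/
theorem conj4_cayley_of_endState_of_injective (hE : BenjaminiSchramm1996_conj4_endState) (S : Finset Γ) (hS : Subgroup.closure (S : Set Γ) = ⊤)
    {N : Type} [Group N] [Group.IsNilpotent N] (φ : N →* Γ) (hfi : φ.range.FiniteIndex) (g : Γ)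
    (hpc : criticalProb (mulCayley (↑S : Set Γ)) g < 1) : theta (mulCayley (↑S : Set Γ)) g (criticalProbIOf (mulCayley (↑S : Set Γ)) g) = 0 := by
  haveI := hfi
  haveI : Group.IsNilpotent φ.range := Group.nilpotent_of_surjective φ.rangeRestrict φ.rangeRestrict_surjective
  exact conj4_cayley_of_endState hE S hS φ.range g hpc

/-- **The dichotomy, packaged**: modulo end-state continuity, on every Cayley graph of a finitely generated virtually nilpotent group EITHER `p_c = 1` at every vertex
(the group is virtually cyclic) OR `p_c < 1` and `θ(p_c) = 0` at every vertex. [cite: BenjaminiSchramm1996, Conj. 4; Thm. 1; §2] [cite: LyonsPeres2016, §7.4 Cor. 7.19] -/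
theorem dichotomy_of_endState (hE : BenjaminiSchramm1996_conj4_endState) (S : Finset Γ) (hS : Subgroup.closure (S : Set Γ) = ⊤)
    (N : Subgroup Γ) [N.FiniteIndex] [Group.IsNilpotent N] :
    (∀ g : Γ, criticalProb (mulCayley (↑S : Set Γ)) g = 1) ∨
      ∀ g : Γ, criticalProb (mulCayley (↑S : Set Γ)) g < 1 ∧ theta (mulCayley (↑S : Set Γ)) g (criticalProbIOf (mulCayley (↑S : Set Γ)) g) = 0 := by
  by_cases hvc : ∃ c : Γ, (Subgroup.zpowers c).FiniteIndex
  · exact Or.inl fun g => (VirtNilpotent.criticalProb_eq_one_iff_virtuallyCyclic S hS N g).2 hvc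
  · exact Or.inr fun g => ⟨(VirtNilpotent.criticalProb_lt_one_iff_not_virtuallyCyclic S hS N g).2 hvc,
      criticalContinuity_of_endState hE S hS N hvc g⟩

end EndStateVirtNil

end Summit.CriticalPhenomena.PercolationContinuityZ3.Theorems.Transplant

end
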